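import Summits.BirchSwinnertonDyer.BirchSwinnertonDyer.Theorems.CMKolyvaginAtInertTwoConjugationTypeAtTwo
import Literature.NumberTheory.EllipticCurves.ComplexMultiplicationDeuringFrobeniusProofs
import Literature.NumberTheory.EllipticCurves.PAdicGrossZagierConstantTermProofs
import HarnessLib

/-!
# Route `CMKolyvaginAtInertTwo`, crux `CMKolyvaginExactAtInertTwo` (stmt-BirchSwinnertonDyer-24277):
# a Frobenius above a prime `ℓ` INERT in `ℚ(√Δ_E)` moves a `2`-torsion point (part 1 of the
# `p = 2` Frobenius-form bridge; part 2 = `CMKolyvaginAtInertTwoFrobeniusBridgeAtTwo.lean`)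

Seat `bsd-line-cmk2-p1` g3 (cell `bsd-print-cf2`), `--supports stmt-BirchSwinnertonDyer-24277`
(helper; also serves the supply crux 24276 and route GenusKolyvaginAtTwo's 22137 on its `Δ < 0`
members). THEOREMS ONLY: no definition, no named fact, no `sorry`. Nothing here is about `Ш`; no
item is closed; BSD is not proved by any of this.

WHY. The tree's kernel Kolyvagin machine (`Literature/…/HeegnerPointsKolyvaginPrimary*Proofs`) and
Gross's §§3–9 apparatus consume Kolyvagin primes in GROSS'S form (3.2) (`FrobEqFrobInfty W K (p^M) ℓ`:
an arithmetic Frobenius above `ℓ` acts on `E[p^M]` and on `K` as a complex conjugation). The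
route's cruxes 24276/24277 type them in W. ZHANG'S congruence form at `p = 2` conjoined (rev 8, memo
R6, `Cruxes/CMExactDescentAtTwo/MEMO-tau-line-at-two.md`) with `Rank1Residual.CMInert W ℓ` (`ℓ` inert
in `F = Frac End E = ℚ(√Δ_E)`). For ODD `p` the bridge is the tree's
`AdditiveKoly.frobEqFrobInfty_of_zhang_P` (`hp2 : p ≠ 2`: eigenvectors of both signs from
`det = −1 ≠ 1`); at `p = 2` that is void, and the congruence form alone is NOT enough (memo R6:
Zhang-Kolyvagin primes at `2` with `Frob_ℓ = 1` on `E[2]` exist). The input that replaces it: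

* §1 `isSquare_of_isArithFrobAt_smul_eq` — if an arithmetic Frobenius `σ` at `𝔓 ∣ ℓ` (`ℓ` odd,
  `ℓ ∤ d`) FIXES a square root `s ∈ ℚ̄` of the integer `d`, then `d` is a square mod `ℓ` (Euler's
  criterion: `s ≡ σs ≡ s^ℓ = s·d^{(ℓ−1)/2} (mod 𝔓)`, `s ∉ 𝔓`); contrapositive companion of the
  tree's `DeuringLadic.smul_eq_self_of_isArithFrobAt` (split case: Frobenius fixes `√d`).
* §2 `exists_twoTorsion_smul_ne_of_isArithFrobAt` — **`W` globally minimal, `ℓ ∤ 2N_E`,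
  `Δ_E = d·s²` with `d` a non-square mod `ℓ` ⟹ `Frob_ℓ` MOVES some point of `E(ℚ̄)[2]`**:
  otherwise it fixes the three roots `e_i` of the `2`-division cubic (abscissae of the non-zero
  `2`-torsion points, g2's `KolyvaginEigenTwo.exists_point_two_smul_eq_zero_of_isRoot`), hence
  `δ = 16(e₁−e₂)(e₁−e₃)(e₂−e₃)` with `δ² = 16Δ = 16Δ_min` (Mathlib `Cubic.discr_eq_prod_three_roots`,
  `twoTorsionPolynomial_discr`), so by §1 `16Δ_min`, hence `d`, is a square mod `ℓ` (`ℓ ∤ Δ_min` by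
  good reduction, `Δ_min·den(s)² = d·num(s)²`). Equivalently: `Frob_ℓ` is an ODD permutation of
  `E[2] ∖ 0` iff `ℓ` is inert in `ℚ(√Δ_E)` (`ℚ(E[2]) ⊇ ℚ(√Δ)`, Dokchitser–Dokchitser).

References: [SilvermanAEC2009] III.1 (2-division cubic, `disc = 16Δ`), VII.5.1; [NeukirchANT1999]
Ch. I §8 (8.5), §9 Prop. (9.4); [DokchitserDokchitserMathZ2012] Thm. 1 (`ℚ(E[2]) ⊇ ℚ(√Δ)`);
[GrossLMS1991] §3 (3.2)–(3.3).
-/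

-- single-conjunct summit: `Summit.BirchSwinnertonDyer.BirchSwinnertonDyer.…` repeats the name by design
set_option linter.dupNamespace false
set_option autoImplicit false

noncomputable section

open scoped Classical Pointwise

namespace Summit.BirchSwinnertonDyer.BirchSwinnertonDyer.Theorems.KolyvaginFrobeniusTwo

open WeierstrassCurve Field Function NumberField IsDedekindDomain Rat.HeightOneSpectrum Polynomial
open Literature.NumberTheory.EllipticCurves Literature.NumberTheory.GaloisRepresentations Module
open Literature.NumberTheory.EllipticCurves.Rank1Residual
open Summit.BirchSwinnertonDyer.BirchSwinnertonDyer.Theorems.KolyvaginEigenTwo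

/-! ## §1 A Frobenius fixing `√d` forces `d` to be a square mod `ℓ` -/

section SqrtFrobenius

/-- **If an arithmetic Frobenius above an odd prime `ℓ ∤ d` fixes `√d`, then `d` is a square
mod `ℓ`.** For `d ∈ ℤ`, `s ∈ ℚ̄` with `s² = d`, `v` the place of `ℚ` at `ℓ`, `𝔓 ∣ v` a prime of
`\bar ℤ`, `σ` an arithmetic Frobenius at `𝔓` with `σ • s = s`: `IsSquare (d : ZMod ℓ)`. Proof:
`s ∈ \bar ℤ`, `s − s^ℓ ∈ 𝔓` (Frobenius, `σs = s`), `s^ℓ − s = s·(d^{(ℓ−1)/2} − 1)`, and `s ∉ 𝔓`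
(`s² = d ∉ ℓℤ = 𝔓 ∩ ℤ`), so `ℓ ∣ d^{(ℓ−1)/2} − 1`: Euler's criterion. (Contrapositive companion
of `DeuringLadic.smul_eq_self_of_isArithFrobAt`: at an INERT prime Frobenius negates `√d`.)
[cite: NeukirchANT1999, Ch. I §8 Prop. (8.5) and §9 Prop. (9.4)] -/
theorem isSquare_of_isArithFrobAt_smul_eq {ℓ : ℕ} (hℓ : ℓ.Prime) (hℓ2 : ℓ ≠ 2) {d : ℤ}
    (hℓd : ¬ (ℓ : ℤ) ∣ d) {s : AlgebraicClosure ℚ} (hs : s ^ 2 = (d : AlgebraicClosure ℚ))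
    {v : HeightOneSpectrum (𝓞 ℚ)} (hv : (primesEquiv v : ℕ) = ℓ)
    {𝔓 : Ideal (absIntegers (𝓞 ℚ) ℚ)} (h𝔓 : 𝔓 ∈ v.primesAbove)
    {σ : absoluteGaloisGroup ℚ} (hσ : IsArithFrobAt (𝓞 ℚ) σ 𝔓) (hσs : σ • s = s) :
    IsSquare ((d : ℤ) : ZMod ℓ) := by
  haveI : 𝔓.IsPrime := h𝔓.1
  haveI : Fact ℓ.Prime := ⟨hℓ⟩
  -- `s` as an algebraic integer
  have hsi : IsIntegral (𝓞 ℚ) s := by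
    refine IsIntegral.of_pow two_pos ?_
    rw [hs, show (d : AlgebraicClosure ℚ) = algebraMap (𝓞 ℚ) (AlgebraicClosure ℚ) (d : 𝓞 ℚ) by
      rw [map_intCast]]
    exact isIntegral_algebraMap
  set x : absIntegers (𝓞 ℚ) ℚ := ⟨s, hsi⟩ with hx
  have hxs : (x : AlgebraicClosure ℚ) = s := rfl
  have hx2 : x ^ 2 = (d : absIntegers (𝓞 ℚ) ℚ) := Subtype.ext (by simp [hxs, hs])
  -- `σ • x = x` in `\bar ℤ`
  have hσx : σ • x = x := by
    apply Subtype.ext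
    have : ((σ • x : absIntegers (𝓞 ℚ) ℚ) : AlgebraicClosure ℚ) = σ • s := by
      simp [hx, integralClosure.coe_smul]
    rw [this, hσs, hxs]
  -- Frobenius: `σ • x - x ^ ℓ ∈ 𝔓`, hence `x ^ ℓ - x ∈ 𝔓`
  have hres : v.residueCard = ℓ := by
    rw [← WeierstrassCurve.natCard_residueField_eq_residueCard v,
      WeierstrassCurve.natCard_residueField_adicCompletionIntegers v, hv]
  have hfrob : x ^ ℓ - x ∈ 𝔓 := by
    have h := (HeightOneSpectrum.isArithFrobAt_iff_of_mem_primesAbove h𝔓 σ).mp hσ x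
    rw [hres, hσx] at h
    have : x ^ ℓ - x = -(x - x ^ ℓ) := by ring
    rw [this]
    exact 𝔓.neg_mem h
  -- `x ^ ℓ - x = x * (d ^ (ℓ / 2) - 1)`
  have hodd : ℓ = 2 * (ℓ / 2) + 1 := by
    have := hℓ.eq_two_or_odd'.resolve_left hℓ2
    obtain ⟨k, hk⟩ := this
    omega
  have hfactor : x ^ ℓ - x = x * (((d : absIntegers (𝓞 ℚ) ℚ)) ^ (ℓ / 2) - 1) := by
    conv_lhs => rw [hodd]
    rw [pow_succ, pow_mul, hx2]
    ring
  rw [hfactor] at hfrob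
  -- `ℓ ∈ v`, and `x ∉ 𝔓` (else `d = x² ∈ 𝔓 ∩ ℤ = ℓℤ`)
  have hx𝔓 : x ∉ 𝔓 := by
    intro hmem
    have hd𝔓 : ((d : ℤ) : absIntegers (𝓞 ℚ) ℚ) ∈ 𝔓 := by
      rw [← hx2, pow_two]; exact 𝔓.mul_mem_left _ hmem
    have hdv : ((d : ℤ) : 𝓞 ℚ) ∈ v.asIdeal := by
      rw [h𝔓.2.over, Ideal.mem_under, map_intCast]
      exact hd𝔓
    rw [DeuringLadic.intCast_mem_asIdeal_iff, hv] at hdv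
    exact hℓd hdv
  have hdk : ((d : absIntegers (𝓞 ℚ) ℚ)) ^ (ℓ / 2) - 1 ∈ 𝔓 :=
    ((Ideal.IsPrime.mem_or_mem inferInstance hfrob).resolve_left hx𝔓)
  -- down to `ℤ`: `ℓ ∣ d ^ (ℓ / 2) - 1`
  have hdk' : ((d ^ (ℓ / 2) - 1 : ℤ) : 𝓞 ℚ) ∈ v.asIdeal := by
    rw [h𝔓.2.over, Ideal.mem_under, map_intCast]
    push_cast
    exact hdk
  rw [DeuringLadic.intCast_mem_asIdeal_iff, hv] at hdk'
  -- Euler's criterion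
  have hd0 : ((d : ℤ) : ZMod ℓ) ≠ 0 := by
    rwa [Ne, ZMod.intCast_zmod_eq_zero_iff_dvd]
  refine (ZMod.euler_criterion ℓ hd0).mpr ?_
  have h0 : (((d ^ (ℓ / 2) - 1 : ℤ)) : ZMod ℓ) = 0 := by
    rw [ZMod.intCast_zmod_eq_zero_iff_dvd]; exact hdk'
  push_cast at h0
  exact sub_eq_zero.mp h0

end SqrtFrobenius

/-! ## §2 `ℓ` inert in `ℚ(√Δ_E)` forces `Frob_ℓ` to move a `2`-torsion point -/

section TwoTorsion

variable (W : WeierstrassCurve ℚ) [W.IsElliptic]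

omit [W.IsElliptic] in
/-- The `2`-division cubic commutes with base change to `ℚ̄`, as a `Cubic`. [folklore] -/
private theorem twoTorsionPolynomial_baseChange_eq_map :
    (W.baseChange (AlgebraicClosure ℚ)).twoTorsionPolynomial =
      Cubic.map (algebraMap ℚ (AlgebraicClosure ℚ)) W.twoTorsionPolynomial := by
  simp [baseChange, twoTorsionPolynomial, Cubic.map, map_b₂, map_b₄, map_b₆, map_ofNat]

omit [W.IsElliptic] in
/-- In `E[2]`, `-P = P`. [folklore] -/
theorem neg_eq_self_of_twoTorsion (P : geomTorsion W ((2 : ℕ) : ℤ)) : -P = P := by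
  have h : (2 : ℕ) • P = 0 := AddSubgroup.torsionBy.nsmul P
  rw [two_nsmul] at h
  exact neg_eq_of_add_eq_zero_left h

/-- **An element of `Γ_ℚ` fixing `E[2]` pointwise fixes every root of the `2`-division cubic
in `ℚ̄`**: a root `e` is the abscissa of a point of order `2` (g2's
`KolyvaginEigenTwo.exists_point_two_smul_eq_zero_of_isRoot`), and `Γ_ℚ` acts on points through
the coordinates. [cite: SilvermanAEC2009, III.1 and III.2.3(d)] -/
theorem smul_eq_of_mem_roots_of_forall_smul_eq {σ : absoluteGaloisGroup ℚ}
    (hall : ∀ v : geomTorsion W ((2 : ℕ) : ℤ), σ • v = v) {e : AlgebraicClosure ℚ}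
    (he : e ∈ (Cubic.map (algebraMap ℚ (AlgebraicClosure ℚ)) W.twoTorsionPolynomial).roots) :
    σ • e = e := by
  have ha : W.twoTorsionPolynomial.a ≠ 0 := by change (4 : ℚ) ≠ 0; norm_num
  have ha' : (Cubic.map (algebraMap ℚ (AlgebraicClosure ℚ)) W.twoTorsionPolynomial).a ≠ 0 := by
    change algebraMap ℚ (AlgebraicClosure ℚ) W.twoTorsionPolynomial.a ≠ 0
    exact (_root_.map_ne_zero _).mpr ha
  have hne0 : (Cubic.map (algebraMap ℚ (AlgebraicClosure ℚ)) W.twoTorsionPolynomial).toPoly ≠ 0 :=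
    Cubic.ne_zero_of_a_ne_zero ha'
  have hroot : (Cubic.map (algebraMap ℚ (AlgebraicClosure ℚ)) W.twoTorsionPolynomial).toPoly.IsRoot e :=
    (mem_roots hne0).mp he
  rw [← twoTorsionPolynomial_baseChange_eq_map] at hroot
  obtain ⟨y, hns, h2⟩ := exists_point_two_smul_eq_zero_of_isRoot W hroot
  set P : geomPoints W := Affine.Point.some e y hns with hP
  have hPmem : P ∈ geomTorsion W ((2 : ℕ) : ℤ) := by
    rw [mem_geomTorsion_iff, Nat.cast_ofNat]; exact h2
  have hv := hall ⟨P, hPmem⟩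
  have hv' : σ • P = P := congrArg Subtype.val hv
  have hmap : σ • P = Affine.Point.map ((absoluteGaloisGroup.toAlgEquiv ℚ σ).toAlgHom) P := rfl
  rw [hmap, hP, Affine.Point.map_some] at hv'
  injection hv' with hx hy

/-- **An element of `Γ_ℚ` fixing `E[2]` pointwise fixes a square root of `16·Δ_E`**, namely
`δ = 16(e₁−e₂)(e₁−e₃)(e₂−e₃)` for the roots `e_i ∈ ℚ̄` of the `2`-division cubic
(`δ² = disc = 16Δ`, Mathlib `Cubic.discr_eq_prod_three_roots`, `twoTorsionPolynomial_discr`).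
[cite: SilvermanAEC2009, III.1] [cite: DokchitserDokchitserMathZ2012, Thm. 1 (ℚ(E[2]) ⊇ ℚ(√Δ))] -/
theorem exists_sqrt_discr_smul_eq_of_forall_smul_eq {σ : absoluteGaloisGroup ℚ}
    (hall : ∀ v : geomTorsion W ((2 : ℕ) : ℤ), σ • v = v) :
    ∃ δ : AlgebraicClosure ℚ, δ ^ 2 = algebraMap ℚ (AlgebraicClosure ℚ) (16 * W.Δ) ∧ σ • δ = δ := by
  have ha : W.twoTorsionPolynomial.a ≠ 0 := by change (4 : ℚ) ≠ 0; norm_num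
  have hsplit : (W.twoTorsionPolynomial.toPoly.map (algebraMap ℚ (AlgebraicClosure ℚ))).Splits :=
    IsAlgClosed.splits _
  obtain ⟨e₁, e₂, e₃, h3⟩ := (Cubic.splits_iff_roots_eq_three ha).mp hsplit
  have h1 : σ • e₁ = e₁ := smul_eq_of_mem_roots_of_forall_smul_eq W hall (by rw [h3]; simp)
  have h2 : σ • e₂ = e₂ := smul_eq_of_mem_roots_of_forall_smul_eq W hall (by rw [h3]; simp)
  have h3' : σ • e₃ = e₃ := smul_eq_of_mem_roots_of_forall_smul_eq W hall (by rw [h3]; simp)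
  have hdisc := Cubic.discr_eq_prod_three_roots ha h3
  rw [twoTorsionPolynomial_discr] at hdisc
  have ha4 : W.twoTorsionPolynomial.a = 4 := rfl
  rw [ha4] at hdisc
  have h44 : algebraMap ℚ (AlgebraicClosure ℚ) 4 = 4 := map_ofNat _ 4
  rw [h44] at hdisc
  refine ⟨4 * 4 * (e₁ - e₂) * (e₁ - e₃) * (e₂ - e₃), hdisc.symm, ?_⟩
  have h4 : σ • (4 : AlgebraicClosure ℚ) = 4 := by
    rw [absoluteGaloisGroup.smul_def, map_ofNat]
  simp only [smul_mul', smul_sub, h1, h2, h3', h4]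

/-- **`ℓ` inert in `ℚ(√Δ_E)` ⟹ `Frob_ℓ` moves a point of `E[2]`.** Let `W/ℚ` be globally minimal
with good reduction at the odd prime `ℓ`, `Δ(W) = d·s²` (`d ∈ ℤ`, `s ∈ ℚ`) with `d` a NON-square
mod `ℓ`, `v` the place at `ℓ`, `𝔓 ∣ v` a prime of `\bar ℤ`, `σ ∈ Γ_ℚ` an arithmetic Frobenius at
`𝔓`. Then `σ • P ≠ P` for some `P ∈ E(ℚ̄)[2]`: otherwise `σ` fixes `δ` with `δ² = 16Δ = 16Δ_min`
(§2), so `16Δ_min` is a square mod `ℓ` (§1; `ℓ ∤ 16Δ_min` by good reduction), and so is `d`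
(`Δ_min·den(s)² = d·num(s)²`, `ℓ ∤ num(s)·den(s)`). I.e. `Frob_ℓ` is an odd permutation of
`E[2] ∖ 0`. [cite: SilvermanAEC2009, III.1, VII.5.1] [cite: NeukirchANT1999, Ch. I §8 (8.5), §9 (9.4)] -/
theorem exists_twoTorsion_smul_ne_of_isArithFrobAt [W.IsGloballyMinimal] {ℓ : ℕ} [Fact ℓ.Prime]
    (hℓ2 : ℓ ≠ 2) (hgood : W.HasGoodReductionAtPrime ℓ) {d : ℤ} {s : ℚ} (hΔ : W.Δ = d * s ^ 2)
    (hns : ¬ IsSquare ((d : ℤ) : ZMod ℓ)) {v : HeightOneSpectrum (𝓞 ℚ)}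
    (hv : (primesEquiv v : ℕ) = ℓ) {𝔓 : Ideal (absIntegers (𝓞 ℚ) ℚ)} (h𝔓 : 𝔓 ∈ v.primesAbove)
    {σ : absoluteGaloisGroup ℚ} (hσ : IsArithFrobAt (𝓞 ℚ) σ 𝔓) :
    ∃ P : geomTorsion W ((2 : ℕ) : ℤ), σ • P ≠ P := by
  have hℓ : ℓ.Prime := Fact.out
  by_contra hall
  push Not at hall
  obtain ⟨δ, hδ2, hσδ⟩ := exists_sqrt_discr_smul_eq_of_forall_smul_eq W hall
  -- `16 Δ = 16 Δ_min`, an integer prime to `ℓ`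
  set D : ℤ := minimalDiscriminantInt W with hD
  have hDΔ : (D : ℚ) = W.Δ := cast_minimalDiscriminantInt W
  have hℓD : ¬ (ℓ : ℤ) ∣ D := W.not_dvd_minimalDiscriminantInt_of_hasGoodReductionAtPrime ℓ hgood
  have hℓ' : Prime (ℓ : ℤ) := Nat.prime_iff_prime_int.mp hℓ
  have hℓ16D : ¬ (ℓ : ℤ) ∣ 16 * D := by
    intro h
    rcases hℓ'.dvd_or_dvd h with h16 | hD'
    · have : (ℓ : ℤ) ∣ 2 ^ 4 := by norm_num; exact h16
      have h2' := hℓ'.dvd_of_dvd_pow this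
      have : ℓ ∣ 2 := by exact_mod_cast h2'
      exact hℓ2 ((Nat.prime_dvd_prime_iff_eq hℓ Nat.prime_two).mp this)
    · exact hℓD hD'
  have hδ2' : δ ^ 2 = ((16 * D : ℤ) : AlgebraicClosure ℚ) := by
    rw [hδ2, ← map_intCast (algebraMap ℚ (AlgebraicClosure ℚ))]
    congr 1
    push_cast
    rw [hDΔ]
  -- §1: `16 Δ_min` is a square mod `ℓ`
  have hsq16 : IsSquare (((16 * D : ℤ)) : ZMod ℓ) :=
    isSquare_of_isArithFrobAt_smul_eq hℓ hℓ2 hℓ16D hδ2' hv h𝔓 hσ hσδ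
  -- hence `Δ_min` is
  have h4 : ((4 : ℤ) : ZMod ℓ) ≠ 0 := by
    rw [Ne, ZMod.intCast_zmod_eq_zero_iff_dvd]
    intro h
    have : (ℓ : ℤ) ∣ 2 ^ 2 := by norm_num; exact h
    have h2' := hℓ'.dvd_of_dvd_pow this
    have : ℓ ∣ 2 := by exact_mod_cast h2'
    exact hℓ2 ((Nat.prime_dvd_prime_iff_eq hℓ Nat.prime_two).mp this)
  have hsqD : IsSquare ((D : ℤ) : ZMod ℓ) := by
    refine DeuringLadic.isSquare_of_isSquare_mul_sq h4 ?_
    have : ((D : ℤ) : ZMod ℓ) * ((4 : ℤ) : ZMod ℓ) ^ 2 = (((16 * D : ℤ)) : ZMod ℓ) := by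
      push_cast; ring
    rw [this]; exact hsq16
  -- `Δ_min · den² = d · num²`
  have hden : (s.den : ℤ) ≠ 0 := by exact_mod_cast s.den_nz
  have hrel : D * (s.den : ℤ) ^ 2 = d * s.num ^ 2 := by
    have h1 : (D : ℚ) * (s.den : ℚ) ^ 2 = d * (s.num : ℚ) ^ 2 := by
      rw [hDΔ, hΔ, ← Rat.mul_den_eq_num s]; ring
    exact_mod_cast h1
  -- `ℓ ∤ d` (a non-square mod `ℓ` is non-zero), `ℓ ∤ den s`, `ℓ ∤ num s`
  have hd0 : ((d : ℤ) : ZMod ℓ) ≠ 0 := by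
    intro h0; apply hns; rw [h0]; exact ⟨0, by ring⟩
  have hℓd : ¬ (ℓ : ℤ) ∣ d := by rwa [← ZMod.intCast_zmod_eq_zero_iff_dvd]
  have hcop : IsCoprime s.num (s.den : ℤ) := by
    rw [Int.isCoprime_iff_gcd_eq_one]
    exact_mod_cast s.reduced
  have hden0 : ((s.den : ℕ) : ZMod ℓ) ≠ 0 := by
    rw [Ne, ZMod.natCast_eq_zero_iff]
    intro hdvd'
    have hdvd : (ℓ : ℤ) ∣ (s.den : ℤ) := by exact_mod_cast hdvd'
    have h' : (ℓ : ℤ) ∣ d * s.num ^ 2 := by rw [← hrel]; exact dvd_mul_of_dvd_right (dvd_pow hdvd two_ne_zero) _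
    rcases hℓ'.dvd_or_dvd h' with h'' | h''
    · exact hℓd h''
    · have hnum := hℓ'.dvd_of_dvd_pow h''
      exact hℓ'.not_unit (hcop.isUnit_of_dvd' hnum hdvd)
  have hnum0 : ((s.num : ℤ) : ZMod ℓ) ≠ 0 := by
    rw [Ne, ZMod.intCast_zmod_eq_zero_iff_dvd]
    intro hdvd
    have h' : (ℓ : ℤ) ∣ D * (s.den : ℤ) ^ 2 := by rw [hrel]; exact dvd_mul_of_dvd_right (dvd_pow hdvd two_ne_zero) _
    rcases hℓ'.dvd_or_dvd h' with h'' | h''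
    · exact hℓD h''
    · have hden' := hℓ'.dvd_of_dvd_pow h''
      exact hℓ'.not_unit (hcop.isUnit_of_dvd' hdvd hden')
  -- `d = Δ_min · (den/num)²` is a square mod `ℓ`
  apply hns
  obtain ⟨r, hr⟩ := hsqD
  have hrel' := congrArg (fun z : ℤ => (z : ZMod ℓ)) hrel
  push_cast at hrel'
  have hnum2 : ((s.num : ℤ) : ZMod ℓ) ^ 2 ≠ 0 := pow_ne_zero _ hnum0
  refine ⟨r * ((s.den : ℕ) : ZMod ℓ) / ((s.num : ℤ) : ZMod ℓ), ?_⟩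
  calc ((d : ℤ) : ZMod ℓ)
      = (d : ZMod ℓ) * ((s.num : ℤ) : ZMod ℓ) ^ 2 / ((s.num : ℤ) : ZMod ℓ) ^ 2 := by
        rw [mul_div_cancel_right₀ _ hnum2]
    _ = ((D : ℤ) : ZMod ℓ) * ((s.den : ℕ) : ZMod ℓ) ^ 2 / ((s.num : ℤ) : ZMod ℓ) ^ 2 := by rw [hrel']
    _ = r * ((s.den : ℕ) : ZMod ℓ) / ((s.num : ℤ) : ZMod ℓ) * (r * ((s.den : ℕ) : ZMod ℓ) / ((s.num : ℤ) : ZMod ℓ)) := by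
        rw [hr]; ring

end TwoTorsion


end Summit.BirchSwinnertonDyer.BirchSwinnertonDyer.Theorems.KolyvaginFrobeniusTwo

end
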